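import Summits.KontsevichZagierPeriods.KontsevichZagierPeriods.Theorems.RootDecompZetaThreeFrontierWordMatchPreludeP7

/-! # `RootDecompZetaThreeFrontierWordMatchPreludeP8` — part 2/2 of the mechanical ≤360-line split of `src.lean`
(split by the decomp-kz census seat for landing; mathematics unchanged; part 2 continues part 1). -/

noncomputable section

namespace Summit.KontsevichZagierPeriods.RootDecompZetaThreeFrontier.WordLayer
open Set MeasureTheory Literature.NumberTheory.Transcendental
open Literature.ModelTheory.ExponentialFields (IsSemialgebraic)
open Summit.KontsevichZagierPeriods.KontsevichZagierPeriods.Theorems.RootDecompZetaThreeFrontierWordMoves (mem_simplex_two_iff mem_simplex_three_iff)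

section IBPT2

/-! (private copy of `snocB3_zero` — its public twin in this chain was privatised under the dedup.landed policy) -/
/-- Auxiliary step `snocB3_zero`. [bookkeeping] -/
private theorem snocB3_zero (x : Fin 2 → ℝ) (t : ℝ) : (Fin.snoc x t : Fin 3 → ℝ) 0 = x 0 := rfl

/-! (private copy of `snocB3_two` — its public twin in this chain was privatised under the dedup.landed policy) -/
/-- Auxiliary step `snocB3_two`. [bookkeeping] -/
private theorem snocB3_two (x : Fin 2 → ℝ) (t : ℝ) : (Fin.snoc x t : Fin 3 → ℝ) 2 = t := rfl

/-! (private copy of `snocB3_one` — its public twin in this chain was privatised under the dedup.landed policy) -/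
/-- Auxiliary step `snocB3_one`. [bookkeeping] -/
private theorem snocB3_one (x : Fin 2 → ℝ) (t : ℝ) : (Fin.snoc x t : Fin 3 → ℝ) 1 = x 1 := rfl

/-- the coordinate functions of `s ↦ (y₀, y₁, s)` and their derivatives, read through `∂₂ Xᵢ` -/
theorem hasDerivAt_snoc_apply (y : Fin 2 → ℝ) (i : Fin 3) (t : ℝ) :
    HasDerivAt (fun s => (Fin.snoc y s : Fin 3 → ℝ) i)
      (MvPolynomial.aeval (Fin.snoc y t : Fin 3 → ℝ) (MvPolynomial.pderiv 2 (MvPolynomial.X i : MvPolynomial (Fin 3) ℚ))) t := by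
  by_cases hi : i = 2
  · subst hi
    rw [MvPolynomial.pderiv_X_self, map_one]
    exact hasDerivAt_id t
  · rw [MvPolynomial.pderiv_X_of_ne hi, map_zero]
    obtain ⟨j, rfl⟩ := Fin.exists_castSucc_eq.2 hi
    simp only [Fin.snoc_castSucc]
    exact hasDerivAt_const t (y j)

/-- differentiation of `s ↦ P(y₀, y₁, s)` is evaluation of `∂₂P` -/
theorem hasDerivAt_aeval_snoc (y : Fin 2 → ℝ) (t : ℝ) (P : MvPolynomial (Fin 3) ℚ) :
    HasDerivAt (fun s => MvPolynomial.aeval (Fin.snoc y s : Fin 3 → ℝ) P)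
      (MvPolynomial.aeval (Fin.snoc y t : Fin 3 → ℝ) (MvPolynomial.pderiv 2 P)) t := by
  induction P using MvPolynomial.induction_on with
  | C a =>
    simp only [MvPolynomial.aeval_C, MvPolynomial.pderiv_C, map_zero]
    exact hasDerivAt_const t _
  | add p q hp hq =>
    simp only [map_add]
    exact hp.add hq
  | mul_X p i hp =>
    have hf : (fun s => MvPolynomial.aeval (Fin.snoc y s : Fin 3 → ℝ) (p * MvPolynomial.X i)) =
        fun s => MvPolynomial.aeval (Fin.snoc y s : Fin 3 → ℝ) p * (Fin.snoc y s : Fin 3 → ℝ) i :=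
      funext fun s => by rw [map_mul, MvPolynomial.aeval_X]
    rw [hf, MvPolynomial.pderiv_mul, map_add, map_mul, map_mul, MvPolynomial.aeval_X]
    exact hp.mul (hasDerivAt_snoc_apply y i t)

/-- continuity of `s ↦ P(y₀, y₁, s)` -/
theorem continuous_aeval_snoc (y : Fin 2 → ℝ) (P : MvPolynomial (Fin 3) ℚ) :
    Continuous (fun s => MvPolynomial.aeval (Fin.snoc y s : Fin 3 → ℝ) P) :=
  continuous_iff_continuousAt.2 fun s => (hasDerivAt_aeval_snoc y s P).continuousAt

/-- the IBP numerator `∂₂P·(1-t₂)(t₀-t₂) + P·(γ₂ (t₀-t₂) + α (1-t₂))` -/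
noncomputable def ibpQ (P : MvPolynomial (Fin 3) ℚ) (γ₂ α : ℕ) : MvPolynomial (Fin 3) ℚ :=
  MvPolynomial.pderiv 2 P * ((MvPolynomial.C 1 - MvPolynomial.X 2) * (MvPolynomial.X 0 - MvPolynomial.X 2)) +
    P * (MvPolynomial.C (γ₂ : ℚ) * (MvPolynomial.X 0 - MvPolynomial.X 2) + MvPolynomial.C (α : ℚ) * (MvPolynomial.C 1 - MvPolynomial.X 2))

/-- the combined boundary numerator `P(y₀,y₁,y₁)·y₀^α - P(y₀,y₁,0)·(1-y₁)^γ₂ (y₀-y₁)^α ∈ ℚ[y₀,y₁]` -/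
noncomputable def ibpB (P : MvPolynomial (Fin 3) ℚ) (γ₂ α : ℕ) : MvPolynomial (Fin 2) ℚ :=
  MvPolynomial.bind₁ ![MvPolynomial.X 0, MvPolynomial.X 1, MvPolynomial.X 1] P * MvPolynomial.X 0 ^ α -
    MvPolynomial.bind₁ ![MvPolynomial.X 0, MvPolynomial.X 1, 0] P * ((MvPolynomial.C 1 - MvPolynomial.X 1) ^ γ₂ *
      (MvPolynomial.X 0 - MvPolynomial.X 1) ^ α)

/-- Auxiliary step `layerF_sa_band`. [bookkeeping] -/
theorem layerF_sa_band (P : MvPolynomial (Fin 3) ℚ) (β₀ β₁ γ₁ γ₂ α : ℕ) :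
    IsSemialgebraicFunOn ℚ bandB3 (layerF P β₀ β₁ γ₁ γ₂ α) := by
  refine (isSemialgebraicFunOn_aeval_div_aeval isSemialgebraic_bandB3 P
    (MvPolynomial.X 0 ^ β₀ * MvPolynomial.X 1 ^ β₁ * (MvPolynomial.C 1 - MvPolynomial.X 1) ^ γ₁ *
      (MvPolynomial.C 1 - MvPolynomial.X 2) ^ γ₂ * (MvPolynomial.X 0 - MvPolynomial.X 2) ^ α) fun z hz => ?_).congr
    fun z hz => ?_
  · obtain ⟨h0, h1, h1', h2', hd⟩ := bandB3_facts hz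
    simp only [map_mul, map_pow, map_sub, MvPolynomial.aeval_X, map_one]
    exact mul_ne_zero (mul_ne_zero (mul_ne_zero (mul_ne_zero (pow_ne_zero _ h0) (pow_ne_zero _ h1)) (pow_ne_zero _ h1'))
      (pow_ne_zero _ h2')) (pow_ne_zero _ hd)
  · simp only [map_mul, map_pow, map_sub, MvPolynomial.aeval_X, map_one, layerF]

/-- Auxiliary step `natCast_mul_pow_pred`. [bookkeeping] -/
theorem natCast_mul_pow_pred (n : ℕ) (x : ℝ) (hx : x ≠ 0) : (n : ℝ) * x ^ (n - 1) = n * x ^ n / x := by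
  cases n with
  | zero => simp
  | succ k =>
    rw [Nat.add_sub_cancel, pow_succ]
    field_simp

/-- Auxiliary step `layerF_cont`. [bookkeeping] -/
theorem layerF_cont (P : MvPolynomial (Fin 3) ℚ) (β₀ β₁ γ₁ γ₂ α : ℕ) : ∀ y ∈ KZ.openOrderedSimplex 2,
    ContinuousOn (fun s => layerF P β₀ β₁ γ₁ γ₂ α (Fin.snoc y s)) (Icc 0 (y (Fin.last 1))) := by
  intro y hy
  obtain ⟨h1, h10, h0⟩ := (mem_simplex_two_iff y).1 hy
  show ContinuousOn (fun s => MvPolynomial.aeval (Fin.snoc y s : Fin 3 → ℝ) P /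
    (y 0 ^ β₀ * y 1 ^ β₁ * (1 - y 1) ^ γ₁ * (1 - s) ^ γ₂ * (y 0 - s) ^ α)) (Icc 0 (y 1))
  refine ContinuousOn.div (continuous_aeval_snoc y P).continuousOn (by fun_prop) fun s hs => ?_
  have hs1 : s ≤ y 1 := hs.2
  have hy0 : y 0 ≠ 0 := by linarith
  have hy1 : y 1 ≠ 0 := by linarith
  have hy1' : (1 : ℝ) - y 1 ≠ 0 := by linarith
  have hu : (1 : ℝ) - s ≠ 0 := by linarith
  have hv : y 0 - s ≠ 0 := by linarith
  exact mul_ne_zero (mul_ne_zero (mul_ne_zero (mul_ne_zero (pow_ne_zero _ hy0) (pow_ne_zero _ hy1)) (pow_ne_zero _ hy1'))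
    (pow_ne_zero _ hu)) (pow_ne_zero _ hv)

/-- **`∂₂ (P/den(β₀,β₁,γ₁,γ₂,α)) = ibpQ(P)/den(β₀,β₁,γ₁,γ₂+1,α+1)`** on the fibres -/
theorem layerF_der (P : MvPolynomial (Fin 3) ℚ) (β₀ β₁ γ₁ γ₂ α : ℕ) : ∀ y ∈ KZ.openOrderedSimplex 2, ∀ t ∈ Ioo 0 (y (Fin.last 1)),
    HasDerivAt (fun s => layerF P β₀ β₁ γ₁ γ₂ α (Fin.snoc y s)) (layerF (ibpQ P γ₂ α) β₀ β₁ γ₁ (γ₂ + 1) (α + 1) (Fin.snoc y t)) t := by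
  intro y hy t ht
  obtain ⟨h1, h10, h0⟩ := (mem_simplex_two_iff y).1 hy
  have ht1 : t < y 1 := ht.2
  have hy0 : y 0 ≠ 0 := by linarith
  have hy1 : y 1 ≠ 0 := by linarith
  have hy1' : (1 : ℝ) - y 1 ≠ 0 := by linarith
  have hu : (1 : ℝ) - t ≠ 0 := by linarith
  have hv : y 0 - t ≠ 0 := by linarith
  have hN := hasDerivAt_aeval_snoc y t P
  have hE1 : HasDerivAt (fun s : ℝ => (1 - s) ^ γ₂) ((γ₂ : ℝ) * (1 - t) ^ (γ₂ - 1) * (-1)) t :=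
    ((hasDerivAt_id t).const_sub 1).pow γ₂
  have hE2 : HasDerivAt (fun s : ℝ => (y 0 - s) ^ α) ((α : ℝ) * (y 0 - t) ^ (α - 1) * (-1)) t :=
    ((hasDerivAt_id t).const_sub (y 0)).pow α
  have hDen := (hE1.const_mul (y 0 ^ β₀ * y 1 ^ β₁ * (1 - y 1) ^ γ₁)).mul hE2
  have hne : y 0 ^ β₀ * y 1 ^ β₁ * (1 - y 1) ^ γ₁ * (1 - t) ^ γ₂ * (y 0 - t) ^ α ≠ 0 :=
    mul_ne_zero (mul_ne_zero (mul_ne_zero (mul_ne_zero (pow_ne_zero _ hy0) (pow_ne_zero _ hy1)) (pow_ne_zero _ hy1'))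
      (pow_ne_zero _ hu)) (pow_ne_zero _ hv)
  have h := hN.div hDen hne
  show HasDerivAt (fun s => MvPolynomial.aeval (Fin.snoc y s : Fin 3 → ℝ) P /
    (y 0 ^ β₀ * y 1 ^ β₁ * (1 - y 1) ^ γ₁ * (1 - s) ^ γ₂ * (y 0 - s) ^ α)) _ t
  refine h.congr_deriv ?_
  simp only [Pi.mul_apply]
  rw [natCast_mul_pow_pred γ₂ (1 - t) hu, natCast_mul_pow_pred α (y 0 - t) hv]
  simp only [layerF, ibpQ, map_add, map_mul, map_sub, map_natCast, MvPolynomial.aeval_X, map_one,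
    snocB3_zero, snocB3_one, snocB3_two]
  field_simp
  ring

/-- **THE t₂-IBP MOVE**: `[Δ₃, ibpQ(P)/den(β₀,β₁,γ₁,γ₂+1,α+1)] ≡ [Δ₂, ibpB(P)/(y₀^{β₀+α} y₁^{β₁} (1-y₁)^{γ₁+γ₂} (y₀-y₁)^{α})]`
(one Newton–Leibniz move, rule 3, + rule 1 for the band). -/
theorem ibpT2 (P : MvPolynomial (Fin 3) ℚ) (β₀ β₁ γ₁ γ₂ α : ℕ) (r : KZ.IntegralRep 3) (hd : r.domain = KZ.openOrderedSimplex 3)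
    (hi : EqOn r.integrand (layerF (ibpQ P γ₂ α) β₀ β₁ γ₁ (γ₂ + 1) (α + 1)) r.domain) :
    ∃ r' : KZ.IntegralRep 2, r'.domain = KZ.openOrderedSimplex 2 ∧
      EqOn r'.integrand (fun y => MvPolynomial.aeval y (ibpB P γ₂ α) /
        (y 0 ^ (β₀ + α) * y 1 ^ β₁ * (1 - y 1) ^ (γ₁ + γ₂) * (y 0 - y 1) ^ α)) r'.domain ∧
      KZ.of r - KZ.of r' ∈ KZ.relations := by
  obtain ⟨r', hd', hi', hrel⟩ := nlB3 (layerF_sa_band (ibpQ P γ₂ α) β₀ β₁ γ₁ (γ₂ + 1) (α + 1)) (layerF_sa_band P β₀ β₁ γ₁ γ₂ α)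
    (layerF_cont P β₀ β₁ γ₁ γ₂ α) (layerF_der P β₀ β₁ γ₁ γ₂ α) r hd hi
  refine ⟨r', hd', fun y hy => ?_, hrel⟩
  rw [hd'] at hy
  obtain ⟨h1, h10, h0⟩ := (mem_simplex_two_iff y).1 hy
  have hy0 : y 0 ≠ 0 := by linarith
  have hy1 : y 1 ≠ 0 := by linarith
  have hy1' : (1 : ℝ) - y 1 ≠ 0 := by linarith
  have hd01 : y 0 - y 1 ≠ 0 := by linarith
  rw [hi']
  have e1 : (Fin.snoc y (y (Fin.last 1)) : Fin 3 → ℝ) = ![y 0, y 1, y 1] := by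
    funext i; fin_cases i <;> rfl
  have e0 : (Fin.snoc y 0 : Fin 3 → ℝ) = ![y 0, y 1, 0] := by
    funext i; fin_cases i <;> rfl
  have g1 : (fun i => MvPolynomial.aeval y ((![MvPolynomial.X 0, MvPolynomial.X 1, MvPolynomial.X 1] :
      Fin 3 → MvPolynomial (Fin 2) ℚ) i)) = ![y 0, y 1, y 1] := by
    funext i; fin_cases i <;> simp
  have g0 : (fun i => MvPolynomial.aeval y ((![MvPolynomial.X 0, MvPolynomial.X 1, 0] :
      Fin 3 → MvPolynomial (Fin 2) ℚ) i)) = ![y 0, y 1, 0] := by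
    funext i; fin_cases i <;> simp
  show layerF P β₀ β₁ γ₁ γ₂ α (Fin.snoc y (y (Fin.last 1))) - layerF P β₀ β₁ γ₁ γ₂ α (Fin.snoc y 0) = _
  rw [e1, e0]
  simp only [layerF, ibpB, map_sub, map_mul, map_pow, MvPolynomial.aeval_bind₁, g1, g0, MvPolynomial.aeval_X,
    map_one, Matrix.cons_val_zero, Matrix.cons_val_one, Matrix.head_cons, Matrix.cons_val_two, Matrix.tail_cons, sub_zero, one_pow,
    mul_one]
  field_simp
  ring

end IBPT2

end Summit.KontsevichZagierPeriods.RootDecompZetaThreeFrontier.WordLayer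

namespace Summit.KontsevichZagierPeriods.KontsevichZagierPeriods.Cruxes.GZNormalFormWThree.GZLadder

open Set MeasureTheory Literature.NumberTheory.Transcendental
open Summit.KontsevichZagierPeriods.RootDecompZetaThreeFrontier

/-- **THE t₂-IBP ENGINE in route vocabulary**: every class `ibpQ(P)/(t₀^β₀ t₁^β₁ (1-t₁)^γ₁ (1-t₂)^{γ₂+1} (t₀-t₂)^{α+1})` on `Δ₃` is congruent,
by one Newton–Leibniz move, to a genus-zero datum of dimension `2`, hence `CongInto (layerThree ∪ gzLETwo)`. -/
theorem congInto_of_ibpT2 (P : MvPolynomial (Fin 3) ℚ) (β₀ β₁ γ₁ γ₂ α : ℕ) (r : KZ.IntegralRep 3) (hd : r.domain = simplex 3)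
    (hi : EqOn r.integrand (WordLayer.layerF (WordLayer.ibpQ P γ₂ α) β₀ β₁ γ₁ (γ₂ + 1) (α + 1)) r.domain) :
    CongInto (layerThree ∪ gzLETwo) (KZ.of r) := by
  obtain ⟨r', hd', hi', hrel⟩ := WordLayer.ibpT2 P β₀ β₁ γ₁ γ₂ α r hd hi
  refine ⟨KZ.of r', AddSubgroup.subset_closure (Or.inr ⟨2, r', le_rfl, ⟨hd', WordLayer.ibpB P γ₂ α, fun _ _ => α, ![β₀ + α, β₁],
    ![0, γ₁ + γ₂], fun y hy => ?_⟩, rfl⟩), hrel⟩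
  rw [hi' hy]
  simp [Fin.prod_univ_two]

end Summit.KontsevichZagierPeriods.KontsevichZagierPeriods.Cruxes.GZNormalFormWThree.GZLadder

/-! # §31  THE DUALITY MOVE ON `Δ₃` FOR ANY INTEGRAND, and the t₀-IBP ENGINE as its conjugate (decomp-kz lens-1 gen 11).
`σ₃(t) = (1-t₂, 1-t₁, 1-t₀)` maps `Δ₃` onto itself with `|det| = 1`; rule 2 gives `[Δ₃, f] ≡ [Δ₃, f ∘ σ₃]` for every representation.
Conjugating §30: every class `(duP3 (ibpQ P γ₂ α))/(t₀^{γ₂+1} t₁^{γ₁} (1-t₁)^{β₁} (1-t₂)^{β₀} (t₀-t₂)^{α+1})` — i.e. every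
t₀-IBP numerator over a denominator with t₀- and diagonal exponents `≥ 1` — is `CongInto (layerThree ∪ gzLETwo)`. -/

namespace Summit.KontsevichZagierPeriods.KontsevichZagierPeriods.Theorems.RootDecompZetaThreeFrontierWordMoves

open Set MeasureTheory Literature.NumberTheory.Transcendental
open Literature.ModelTheory.ExponentialFields (IsSemialgebraic)

section DualMoveThree

/-- Auxiliary step `isSemialgebraicMapOn_duΦ`. [bookkeeping] -/
theorem isSemialgebraicMapOn_duΦ : IsSemialgebraicMapOn ℚ (KZ.openOrderedSimplex 3) duΦ :=
  (isSemialgebraicMapOn_aeval (KZ.isSemialgebraic_openOrderedSimplex 3) ![MvPolynomial.C 1 - MvPolynomial.X 2,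
    MvPolynomial.C 1 - MvPolynomial.X 1, MvPolynomial.C 1 - MvPolynomial.X 0]).congr fun z _ => by
      funext j
      fin_cases j <;> simp [duΦ_zero, duΦ_one, duΦ_two]

/-- **the duality move on `Δ₃` for ANY integrand** (rule 2 with the involution `σ₃`): if `r.integrand = r'.integrand ∘ σ₃` on `Δ₃`
then `[r] ≡ [r']`. [Kontsevich–Zagier 2001 §1.2 rule (2)] -/
theorem dual_move3 (r r' : KZ.IntegralRep 3) (hd : r.domain = KZ.openOrderedSimplex 3) (hd' : r'.domain = KZ.openOrderedSimplex 3)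
    (h : ∀ z ∈ KZ.openOrderedSimplex 3, r.integrand z = r'.integrand (duΦ z)) : KZ.of r - KZ.of r' ∈ KZ.relations := by
  have hΦsa : IsSemialgebraicMapOn ℚ r.domain duΦ := by rw [hd]; exact isSemialgebraicMapOn_duΦ
  have hder : ∀ x ∈ r.domain, HasFDerivWithinAt duΦ duL r.domain x := fun x _ => (hasFDerivAt_duΦ x).hasFDerivWithinAt
  have hinj : InjOn duΦ r.domain := fun a _ b _ hab => by
    have := congrArg duΦ hab
    rwa [duΦ_duΦ, duΦ_duΦ] at this
  have hdom : r'.domain = duΦ '' r.domain := by rw [hd, hd', image_duΦ]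
  refine KZ.changeOfVariablesRel_subset_relations ⟨3, r, r', duΦ, fun _ => duL, hΦsa, hder, hinj, hdom, fun z hz => ?_, rfl⟩
  have hz' : z ∈ KZ.openOrderedSimplex 3 := by rw [← hd]; exact hz
  show r.integrand z = r'.integrand (duΦ z) * |duL.det|
  rw [abs_det_duL, mul_one, h z hz']

/-- the dual representation `σ₃^* r = [Δ₃, r.integrand ∘ σ₃]` -/
noncomputable def dualRep3 (r : KZ.IntegralRep 3) (hd : r.domain = KZ.openOrderedSimplex 3) : KZ.IntegralRep 3 :=
  ⟨KZ.openOrderedSimplex 3, fun t => r.integrand (duΦ t), KZ.isSemialgebraic_openOrderedSimplex 3,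
    IsSemialgebraicFunOn.comp_isSemialgebraicMapOn_holds (hd ▸ r.isSemialgebraicFunOn_integrand) isSemialgebraicMapOn_duΦ
      fun _ ht => mem_simplex_three_duΦ ht,
    integrableOn_comp_duΦ (hd ▸ r.integrableOn)⟩

/-- Auxiliary step `dualRep3_domain`. [bookkeeping] -/
theorem dualRep3_domain (r : KZ.IntegralRep 3) (hd : r.domain = KZ.openOrderedSimplex 3) :
    (dualRep3 r hd).domain = KZ.openOrderedSimplex 3 := rfl

/-- Auxiliary step `dualRep3_integrand`. [bookkeeping] -/
theorem dualRep3_integrand (r : KZ.IntegralRep 3) (hd : r.domain = KZ.openOrderedSimplex 3) (t : Fin 3 → ℝ) :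
    (dualRep3 r hd).integrand t = r.integrand (duΦ t) := rfl

/-- `[r] ≡ [σ₃^* r]` -/
theorem dual_move3' (r : KZ.IntegralRep 3) (hd : r.domain = KZ.openOrderedSimplex 3) :
    KZ.of r - KZ.of (dualRep3 r hd) ∈ KZ.relations :=
  dual_move3 r (dualRep3 r hd) hd rfl fun z _ => by rw [dualRep3_integrand, duΦ_duΦ]

end DualMoveThree

end Summit.KontsevichZagierPeriods.KontsevichZagierPeriods.Theorems.RootDecompZetaThreeFrontierWordMoves

namespace Summit.KontsevichZagierPeriods.KontsevichZagierPeriods.Cruxes.GZNormalFormWThree.GZLadder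

open Set MeasureTheory Literature.NumberTheory.Transcendental
open Summit.KontsevichZagierPeriods.RootDecompZetaThreeFrontier
open Summit.KontsevichZagierPeriods.KontsevichZagierPeriods.Theorems.RootDecompZetaThreeFrontierWordMoves (dualRep3 dual_move3'
  dualRep3_integrand)

/-- `CongInto` is transported along the duality move -/
theorem congInto_of_dual (S : Set KZ.FormalRep) (r : KZ.IntegralRep 3) (hd : r.domain = KZ.openOrderedSimplex 3)
    (h : CongInto S (KZ.of (dualRep3 r hd))) : CongInto S (KZ.of r) := by
  obtain ⟨m, hm, hrel⟩ := h
  refine ⟨m, hm, ?_⟩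
  have e : KZ.of r - m = (KZ.of r - KZ.of (dualRep3 r hd)) + (KZ.of (dualRep3 r hd) - m) := by abel
  rw [e]
  exact add_mem (dual_move3' r hd) hrel

/-- the σ₃-conjugate of a 5-factor class is a 5-factor class with the exponents reflected: `(β₀,β₁,γ₁,γ₂,α) ↦ (γ₂,γ₁,β₁,β₀,α)` -/
theorem layerF_duΦ (Q : MvPolynomial (Fin 3) ℚ) (β₀ β₁ γ₁ γ₂ α : ℕ) (t : Fin 3 → ℝ) :
    WordLayer.layerF Q β₀ β₁ γ₁ γ₂ α
        (Summit.KontsevichZagierPeriods.KontsevichZagierPeriods.Theorems.RootDecompZetaThreeFrontierWordMoves.duΦ t) =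
      WordLayer.layerF (WordLayer.duP3 Q) γ₂ γ₁ β₁ β₀ α t := by
  show WordLayer.layerF Q β₀ β₁ γ₁ γ₂ α (WordLayer.duΦ t) = _
  simp only [WordLayer.layerF, WordLayer.aeval_duP3, WordLayer.duΦ_zero, WordLayer.duΦ_one, WordLayer.duΦ_two, sub_sub_cancel]
  ring

/-- **THE t₀-IBP ENGINE** (§30 conjugated by §31): every class `duP3(ibpQ P γ₂ α)/(t₀^{γ₂+1} t₁^{γ₁} (1-t₁)^{β₁} (1-t₂)^{β₀} (t₀-t₂)^{α+1})`
on `Δ₃` is `CongInto (layerThree ∪ gzLETwo)`. -/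
theorem congInto_of_ibpT0 (P : MvPolynomial (Fin 3) ℚ) (β₀ β₁ γ₁ γ₂ α : ℕ) (r : KZ.IntegralRep 3) (hd : r.domain = simplex 3)
    (hi : EqOn r.integrand (WordLayer.layerF (WordLayer.duP3 (WordLayer.ibpQ P γ₂ α)) (γ₂ + 1) γ₁ β₁ β₀ (α + 1)) r.domain) :
    CongInto (layerThree ∪ gzLETwo) (KZ.of r) := by
  refine congInto_of_dual _ r hd (congInto_of_ibpT2 P β₀ β₁ γ₁ γ₂ α (dualRep3 r hd) rfl fun t ht => ?_)
  rw [dualRep3_integrand, hi (by rw [hd]; exact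
    Summit.KontsevichZagierPeriods.KontsevichZagierPeriods.Theorems.RootDecompZetaThreeFrontierWordMoves.mem_simplex_three_duΦ ht),
    ← layerF_duΦ, Summit.KontsevichZagierPeriods.KontsevichZagierPeriods.Theorems.RootDecompZetaThreeFrontierWordMoves.duΦ_duΦ]

end Summit.KontsevichZagierPeriods.KontsevichZagierPeriods.Cruxes.GZNormalFormWThree.GZLadder

end
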